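import Summits.Ventures.PercRepro.S1KillMixedLadder
import Summits.Ventures.PercRepro.S1CellNineThirteen

/-!
# PercRepro — THE CELLS `(9, 7)` AND `(9, 5)` MODULO CAPS AND A TRIANGLE BOUND (p2, gen 26; SUBCLAIM-S1 §6.10)

The last two row-9 cells have «none» lines — triangle counts at which no four-circuit cap closes the kernel line:
`t = 9, 10` on the `16`-point core of `(9, 7)` (`triT 7 16 = 10`) and `t = 6` on the `14`- and `13`-point cores of
`(9, 5)` (`triT 5 14 = triT 5 13 = 6`). Here they are excluded by a triangle-bound hypothesis (`s₃ ≤ 8`, resp. `≤ 5`),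
and the remaining lines are priced on the mixed kill with bounded cap tables (exact twin mining/p2/g26/caps9m.py).

* **`c025_core_nine_seven_of_caps`** — `(9, 7)` modulo (T9,7) «`s₃ ≤ 8` on 16 points», (P9,7,16) at `0 ≤ t ≤ 8`,
  (P9,7,15) at `2 ≤ t ≤ 10`, (P9,7,14) at `5 ≤ t ≤ 10`;
* **`c025_core_nine_five_of_caps`** — `(9, 5)` modulo (T9,5) «`s₃ ≤ 5` on 14 and on 13 points», (P9,5,14) at
  `1 ≤ t ≤ 5`, (P9,5,13) at `0 ≤ t ≤ 5`, (P9,5,12) at `1 ≤ t ≤ 6`.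
Axioms: standard.
-/

open scoped Matroid

namespace PercRepro

namespace S1

open Set

variable {α : Type}

/-- The values of `gbP` and `triT` on the `(9, 7)` and `(9, 5)` cores. -/
theorem nineSevenFive_values : gbP 7 16 = 47 ∧ gbP 7 15 = 49 ∧ gbP 7 14 = 54 ∧ gbP 5 14 = 22 ∧ gbP 5 13 = 23 ∧
    gbP 5 12 = 24 ∧ triT 7 15 = 10 ∧ triT 7 14 = 10 ∧ triT 5 12 = 6 := by
  decide

/-- The caps of `(9, 7)` on the coloop-free `16`-point core, `t = 0 … 8`. -/
def capNineSeven16 (t : ℕ) : ℕ := [39, 36, 32, 29, 25, 20, 14, 8, 1].getD t 1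
/-- The caps of `(9, 7)` on the one-coloop `15`-point core, `t = 0 … 10` (`49 = gbP 7 15` at `t ≤ 1`). -/
def capNineSeven15 (t : ℕ) : ℕ := [49, 49, 47, 43, 38, 34, 29, 23, 17, 11, 5].getD t 5
/-- The caps of `(9, 7)` on the two-coloop `14`-point core, `t = 0 … 10` (`54 = gbP 7 14` at `t ≤ 4`). -/
def capNineSeven14 (t : ℕ) : ℕ := [54, 54, 54, 54, 54, 50, 45, 40, 35, 30, 25].getD t 25

/-- The triangles in the kill of `(9, 7)`, coloop-free case. -/
def mkNineSeven0 (t : ℕ) : ℕ := min t 6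
/-- The triangles in the kill of `(9, 7)`, one coloop. -/
def mkNineSeven1 (t : ℕ) : ℕ := min t 7
/-- The triangles in the kill of `(9, 7)`, two coloops. -/
def mkNineSeven2 (t : ℕ) : ℕ := min t 10
/-- The four-circuits in the kill of `(9, 7)`, coloop-free and one coloop: `3, 2, 1` at `t = 0, 1, 2`. -/
def m4NineSeven0 (t : ℕ) : ℕ := [3, 2, 1].getD t 0
/-- The four-circuits in the kill of `(9, 7)`, two coloops: `4, 3, 2, 1` at `t = 0 … 3`. -/
def m4NineSeven2 (t : ℕ) : ℕ := [4, 3, 2, 1].getD t 0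

/-- The caps of `(9, 5)` on the coloop-free `14`-point core, `t = 0 … 5` (`22 = gbP 5 14` at `t = 0`). -/
def capNineFive14 (t : ℕ) : ℕ := [22, 19, 16, 12, 8, 3].getD t 3
/-- The caps of `(9, 5)` on the one-coloop `13`-point core, `t = 0 … 5`. -/
def capNineFive13 (t : ℕ) : ℕ := [20, 17, 13, 10, 6, 2].getD t 2
/-- The caps of `(9, 5)` on the two-coloop `12`-point core, `t = 0 … 6` (`24 = gbP 5 12` at `t = 0`). -/
def capNineFive12 (t : ℕ) : ℕ := [24, 23, 19, 16, 13, 9, 5].getD t 5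

/-- The triangles in the kill of `(9, 5)`, coloop-free case. -/
def mkNineFive0 (t : ℕ) : ℕ := min t 4
/-- The triangles in the kill of `(9, 5)`, one coloop. -/
def mkNineFive1 (t : ℕ) : ℕ := min t 5
/-- The triangles in the kill of `(9, 5)`, two coloops. -/
def mkNineFive2 (t : ℕ) : ℕ := min t 6
/-- The four-circuits in the kill of `(9, 5)`, coloop-free: `2, 1` at `t = 0, 1`. -/
def m4NineFive0 (t : ℕ) : ℕ := [2, 1].getD t 0
/-- The four-circuits in the kill of `(9, 5)`, one and two coloops: `3, 2, 1` at `t = 0, 1, 2`. -/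
def m4NineFive1 (t : ℕ) : ℕ := [3, 2, 1].getD t 0

/-- **THE CELL `(9, 7)` MODULO A TRIANGLE BOUND AND THREE CAP TABLES**. -/
theorem c025_core_nine_seven_of_caps (M : Matroid α) [M.Finite] (hR : M.eRank = (9 : ℕ)) (hn : M.E.ncard = 16)
    (hfree : ∀ e ∈ M.E, ∃ A ⊆ M.E \ {e}, e ∉ M.closure A ∧ e ∉ M.closure ((M.E \ {e}) \ A))
    (htri : ∀ (N : Matroid α) [N.Finite],
      (∀ e ∈ N.E, ∃ A ⊆ N.E \ {e}, e ∉ N.closure A ∧ e ∉ N.closure ((N.E \ {e}) \ A)) →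
      N.E.encard = N.eRank + ((7 : ℕ) : ℕ∞) → N.E.ncard = 16 → N.coloops = ∅ →
      {C : Set α | N.IsCircuit C ∧ C.ncard = 3}.ncard ≤ 8)
    (hcap16 : ∀ (N : Matroid α) [N.Finite],
      (∀ e ∈ N.E, ∃ A ⊆ N.E \ {e}, e ∉ N.closure A ∧ e ∉ N.closure ((N.E \ {e}) \ A)) →
      N.E.encard = N.eRank + ((7 : ℕ) : ℕ∞) → N.E.ncard = 16 → N.coloops = ∅ →
      ∀ t, t ≤ 8 → {C : Set α | N.IsCircuit C ∧ C.ncard = 3}.ncard = t →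
      {C : Set α | N.IsCircuit C ∧ C.ncard = 4}.ncard ≤ capNineSeven16 t)
    (hcap15 : ∀ (N : Matroid α) [N.Finite],
      (∀ e ∈ N.E, ∃ A ⊆ N.E \ {e}, e ∉ N.closure A ∧ e ∉ N.closure ((N.E \ {e}) \ A)) →
      N.E.encard = N.eRank + ((7 : ℕ) : ℕ∞) → N.E.ncard = 15 → N.coloops = ∅ →
      ∀ t, 2 ≤ t → t ≤ 10 → {C : Set α | N.IsCircuit C ∧ C.ncard = 3}.ncard = t →
      {C : Set α | N.IsCircuit C ∧ C.ncard = 4}.ncard ≤ capNineSeven15 t)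
    (hcap14 : ∀ (N : Matroid α) [N.Finite],
      (∀ e ∈ N.E, ∃ A ⊆ N.E \ {e}, e ∉ N.closure A ∧ e ∉ N.closure ((N.E \ {e}) \ A)) →
      N.E.encard = N.eRank + ((7 : ℕ) : ℕ∞) → N.E.ncard = 14 → N.coloops = ∅ →
      ∀ t, 5 ≤ t → t ≤ 10 → {C : Set α | N.IsCircuit C ∧ C.ncard = 3}.ncard = t →
      {C : Set α | N.IsCircuit C ∧ C.ncard = 4}.ncard ≤ capNineSeven14 t) :
    ThmN.RLS M 9 4 := by
  rcases (show M.coloops.ncard = 0 ∨ M.coloops.ncard = 1 ∨ M.coloops.ncard = 2 ∨ 3 ≤ M.coloops.ncard by omega)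
    with h | h | h | h
  · have hcol : M.coloops = ∅ := (Set.ncard_eq_zero (M.ground_finite.subset M.coloops_subset_ground)).1 h
    have hd : M.E.encard = M.eRank + ((7 : ℕ) : ℕ∞) := by
      rw [hR, ← M.ground_finite.cast_ncard_eq, hn]; norm_num
    refine rls_of_kill_case_mixed_capT' M (p := 9) (d := 7) hR hn hfree hcol (by norm_num) (by norm_num)
      (P := 8) (S5 := 340) capNineSeven16 (htri M hfree hd hn hcol) ?_ (by decide) mkNineSeven0 m4NineSeven0
      (by decide) (by decide +kernel) (by decide +kernel)
    intro N _ hNfree hNd hNn hNcol t hs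
    exact hcap16 N hNfree hNd hNn hNcol t (by have := htri N hNfree hNd hNn hNcol; omega) hs
  · refine rls_of_ladder_case_kill_mixed_capT M (p := 8) (c := 1) (d := 7) (by norm_num) (by norm_num) hR hn hfree h
      (by norm_num) (by norm_num) (P := 10) (S5 := 351) capNineSeven15 ?_ ?_ (by decide) mkNineSeven1 m4NineSeven0
      (by decide) (by decide +kernel) (by decide +kernel)
    · intro N _ hNfree hNd hNn hNcol
      have := ncard_triangles_le_triT 7 N hNfree hNd hNcol
      rwa [hNn, nineSevenFive_values.2.2.2.2.2.2.1] at this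
    · intro N _ hNfree hNd hNn hNcol t hs
      rcases Nat.lt_or_ge t 2 with h2 | h2
      · have hg := ncard_fourCircuits_le_gbP_of_coloopFree N hNfree hNd hNcol hNn
        rw [nineSevenFive_values.2.1] at hg
        have hc : capNineSeven15 t = 49 := by
          unfold capNineSeven15
          interval_cases t <;> rfl
        rw [hc]; exact hg
      · have h10 : t ≤ 10 := by
          have := ncard_triangles_le_triT 7 N hNfree hNd hNcol
          rwa [hNn, nineSevenFive_values.2.2.2.2.2.2.1, hs] at this
        exact hcap15 N hNfree hNd hNn hNcol t h2 h10 hs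
  · refine rls_of_ladder_case_kill_mixed_capT M (p := 7) (c := 2) (d := 7) (by norm_num) (by norm_num) hR hn hfree h
      (by norm_num) (by norm_num) (P := 10) (S5 := 364) capNineSeven14 ?_ ?_ (by decide) mkNineSeven2 m4NineSeven2
      (by decide) (by decide +kernel) (by decide +kernel)
    · intro N _ hNfree hNd hNn hNcol
      have := ncard_triangles_le_triT 7 N hNfree hNd hNcol
      rwa [hNn, nineSevenFive_values.2.2.2.2.2.2.2.1] at this
    · intro N _ hNfree hNd hNn hNcol t hs
      rcases Nat.lt_or_ge t 5 with h5 | h5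
      · have hg := ncard_fourCircuits_le_gbP_of_coloopFree N hNfree hNd hNcol hNn
        rw [nineSevenFive_values.2.2.1] at hg
        have hc : capNineSeven14 t = 54 := by
          unfold capNineSeven14
          interval_cases t <;> rfl
        rw [hc]; exact hg
      · have h10 : t ≤ 10 := by
          have := ncard_triangles_le_triT 7 N hNfree hNd hNcol
          rwa [hNn, nineSevenFive_values.2.2.2.2.2.2.2.1, hs] at this
        exact hcap14 N hNfree hNd hNn hNcol t h5 h10 hs
  · exact rls_of_coloops_lossy M (p := 6) (c := 3) (hR.trans (by norm_num)) (by norm_num) h phiK_nine_four_le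

/-- **THE CELL `(9, 5)` MODULO A TRIANGLE BOUND AND THREE CAP TABLES**. -/
theorem c025_core_nine_five_of_caps (M : Matroid α) [M.Finite] (hR : M.eRank = (9 : ℕ)) (hn : M.E.ncard = 14)
    (hfree : ∀ e ∈ M.E, ∃ A ⊆ M.E \ {e}, e ∉ M.closure A ∧ e ∉ M.closure ((M.E \ {e}) \ A))
    (htri : ∀ (N : Matroid α) [N.Finite],
      (∀ e ∈ N.E, ∃ A ⊆ N.E \ {e}, e ∉ N.closure A ∧ e ∉ N.closure ((N.E \ {e}) \ A)) →
      N.E.encard = N.eRank + ((5 : ℕ) : ℕ∞) → 13 ≤ N.E.ncard → N.E.ncard ≤ 14 → N.coloops = ∅ →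
      {C : Set α | N.IsCircuit C ∧ C.ncard = 3}.ncard ≤ 5)
    (hcap14 : ∀ (N : Matroid α) [N.Finite],
      (∀ e ∈ N.E, ∃ A ⊆ N.E \ {e}, e ∉ N.closure A ∧ e ∉ N.closure ((N.E \ {e}) \ A)) →
      N.E.encard = N.eRank + ((5 : ℕ) : ℕ∞) → N.E.ncard = 14 → N.coloops = ∅ →
      ∀ t, 1 ≤ t → t ≤ 5 → {C : Set α | N.IsCircuit C ∧ C.ncard = 3}.ncard = t →
      {C : Set α | N.IsCircuit C ∧ C.ncard = 4}.ncard ≤ capNineFive14 t)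
    (hcap13 : ∀ (N : Matroid α) [N.Finite],
      (∀ e ∈ N.E, ∃ A ⊆ N.E \ {e}, e ∉ N.closure A ∧ e ∉ N.closure ((N.E \ {e}) \ A)) →
      N.E.encard = N.eRank + ((5 : ℕ) : ℕ∞) → N.E.ncard = 13 → N.coloops = ∅ →
      ∀ t, t ≤ 5 → {C : Set α | N.IsCircuit C ∧ C.ncard = 3}.ncard = t →
      {C : Set α | N.IsCircuit C ∧ C.ncard = 4}.ncard ≤ capNineFive13 t)
    (hcap12 : ∀ (N : Matroid α) [N.Finite],
      (∀ e ∈ N.E, ∃ A ⊆ N.E \ {e}, e ∉ N.closure A ∧ e ∉ N.closure ((N.E \ {e}) \ A)) →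
      N.E.encard = N.eRank + ((5 : ℕ) : ℕ∞) → N.E.ncard = 12 → N.coloops = ∅ →
      ∀ t, 1 ≤ t → t ≤ 6 → {C : Set α | N.IsCircuit C ∧ C.ncard = 3}.ncard = t →
      {C : Set α | N.IsCircuit C ∧ C.ncard = 4}.ncard ≤ capNineFive12 t) :
    ThmN.RLS M 9 4 := by
  rcases (show M.coloops.ncard = 0 ∨ M.coloops.ncard = 1 ∨ M.coloops.ncard = 2 ∨ 3 ≤ M.coloops.ncard by omega)
    with h | h | h | h
  · have hcol : M.coloops = ∅ := (Set.ncard_eq_zero (M.ground_finite.subset M.coloops_subset_ground)).1 h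
    have hd : M.E.encard = M.eRank + ((5 : ℕ) : ℕ∞) := by
      rw [hR, ← M.ground_finite.cast_ncard_eq, hn]; norm_num
    refine rls_of_kill_case_mixed_capT' M (p := 9) (d := 5) hR hn hfree hcol (by norm_num) (by norm_num)
      (P := 5) (S5 := 80) capNineFive14 (htri M hfree hd (by omega) (by omega) hcol) ?_ (by decide)
      mkNineFive0 m4NineFive0 (by decide) (by decide +kernel) (by decide +kernel)
    intro N _ hNfree hNd hNn hNcol t hs
    rcases Nat.eq_zero_or_pos t with h0 | hpos
    · have hg := ncard_fourCircuits_le_gbP_of_coloopFree N hNfree hNd hNcol hNn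
      rw [nineSevenFive_values.2.2.2.1] at hg
      rw [h0]; exact hg
    · exact hcap14 N hNfree hNd hNn hNcol t hpos (by have := htri N hNfree hNd (by omega) (by omega) hNcol; omega) hs
  · refine rls_of_ladder_case_kill_mixed_capT M (p := 8) (c := 1) (d := 5) (by norm_num) (by norm_num) hR hn hfree h
      (by norm_num) (by norm_num) (P := 5) (S5 := 84) capNineFive13 ?_ ?_ (by decide) mkNineFive1 m4NineFive1
      (by decide) (by decide +kernel) (by decide +kernel)
    · intro N _ hNfree hNd hNn hNcol
      exact htri N hNfree hNd (by omega) (by omega) hNcol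
    · intro N _ hNfree hNd hNn hNcol t hs
      exact hcap13 N hNfree hNd hNn hNcol t (by have := htri N hNfree hNd (by omega) (by omega) hNcol; omega) hs
  · refine rls_of_ladder_case_kill_mixed_capT M (p := 7) (c := 2) (d := 5) (by norm_num) (by norm_num) hR hn hfree h
      (by norm_num) (by norm_num) (P := 6) (S5 := 89) capNineFive12 ?_ ?_ (by decide) mkNineFive2 m4NineFive1
      (by decide) (by decide +kernel) (by decide +kernel)
    · intro N _ hNfree hNd hNn hNcol
      have := ncard_triangles_le_triT 5 N hNfree hNd hNcol
      rwa [hNn, nineSevenFive_values.2.2.2.2.2.2.2.2] at this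
    · intro N _ hNfree hNd hNn hNcol t hs
      rcases Nat.eq_zero_or_pos t with h0 | hpos
      · have hg := ncard_fourCircuits_le_gbP_of_coloopFree N hNfree hNd hNcol hNn
        rw [nineSevenFive_values.2.2.2.2.2.1] at hg
        rw [h0]; exact hg
      · have h6 : t ≤ 6 := by
          have := ncard_triangles_le_triT 5 N hNfree hNd hNcol
          rwa [hNn, nineSevenFive_values.2.2.2.2.2.2.2.2, hs] at this
        exact hcap12 N hNfree hNd hNn hNcol t hpos h6 hs
  · exact rls_of_coloops_lossy M (p := 6) (c := 3) (hR.trans (by norm_num)) (by norm_num) h phiK_nine_four_le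

end S1

end PercRepro
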